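import Literature.NumberTheory.Rogawski1990.ArchQuotientHSBallVolumeProductUnitary        -- ★ LH3-p01 (g2): (U2) `measure_setOf_descConj_archHSGL_arch_le` («places multiply» on `U(J)_∞ ⧸ Z(γ)`); brings ★ p849029, ★ `archPiEquivCM`, ★ `IsQuotientOf`
import Literature.NumberTheory.Rogawski1990.ArchSchwartzOrbitalIntegralConvergenceGeneric  -- ★ p848851 LH2-p02 (g2): (CONV) modulo `hvol` on `U(J)(L⁺ ⊗ ℝ)` (`integrable_orbitalIntegrand_of_archSchwartzOn_of_volumeGrowth`)
import Literature.NumberTheory.Automorphic.UnitaryGroupArchTopology                        -- ★ instances: `U(J)(L⁺ ⊗ ℝ)` locally compact, second countable, T₂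
import HarnessLib

/-!
# (CONV) at EVERY regular class of `U(J)_∞ = U(J)(L⁺ ⊗ ℝ)`, BY HYPOTHESES: one per-place quotient-growth token (`G_∞ = U(Φ₃)_∞ = U(2,1)^d`, `G′_∞ = U(H)_∞`;
# the `G`-side junction of the (CONV)∕(VOL) chain; Beuzart-Plessis 2020 §1.5, Harish-Chandra 1966 §9)

Topic `NumberTheory/Rogawski1990`; namespace `Literature.NumberTheory.Rogawski1990`.  THEOREMS ONLY (no `def`, no instance, no notation, no axiom, no named fact,
no `sorry`).  Cell `pub/hodgecm-mathlib`, crux H413 (`stmt-HodgeConjecture-24833`), F0∕P3c line LH2 (closer stub `stub_N8`, archimedean inner-form transfer; letters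
O1″ [Shelstad1979 Thm. 4.1] ∕ O3″ [Bouaziz1994 Thm. 6.2.1 (i)] about ★ `ArchSchwartzOn L 3 Φ₃ 1`); seat LH2-p03 (g3), heads (3)(4)(5) of brick (Π′-G) (LH2-plan (g0) GO
2026-09-02T04:15:09Z; heads (1′)(2) = ★ `ArchQuotientHSBallVolumeProductUnitary`, LH3-p01 (g2), by the (q1) no-double-work ruling).  The `G`-SIDE TWIN of ★
`ArchSchwartzOrbitalIntegralConvergenceTotal` (LH3-p04, p848924: the `H_∞` junction).

THE MATHEMATICS ([BeuzartPlessis2020Asterisque, §1.5 (1.5.2)–(1.5.3) p. 31]; [HarishChandra1966, §9]).  Let `det J ≠ 0`, `N ≥ 1`, `g ∈ 𝒞(U(J)_∞)` (★ `ArchSchwartzOn L N J e g`: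
`|g| · archHSGL^e · (1 + log archHSGL)^d ≤ C_d` for all `d`, `archHSGL L N y = ∏_w ‖y_w‖²_HS`, §1), `ν` a Haar measure on `U(J)_∞`, `m` an orbital-measure family in WEIL FORM at
the regular classes (`m c = dν ∕ dt_{γ_c}`, ★ `OrbitalMeasureFamily.IsQuotientOf` — conjunct (W) of the LH2 frame ★ `ArchCompatibleFamiliesG`), `c` a regular class.  The member
`m c` is invariant and Radon (★ `smulInvariantMeasure_quotientMeasure'`, ★ `regular_quotientMeasure`), so «places multiply on the quotient» (★ `measure_setOf_descConj_archHSGL_arch_le`: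
`U(J)_∞ ⧸ Z(γ) ≅ Π_w U(J)_w ⧸ Z_w(γ_w)`, uniqueness of invariant measures, dyadic boxes) turns ONE per-place token — at each complex place `w` SOME non-zero invariant σ-finite
measure `μ_w` on `U(J)_w ⧸ Z_w((γ_c)_w)` finite on compact sets has `μ_w{x̄ ∣ ‖x̄ (γ_c)_w x̄⁻¹‖²_HS ≤ ρ} ≤ C ρ^a` — into `(m c){ȳ ∣ archHSGL(ȳ γ_c ȳ⁻¹) ≤ R} ≤ A R^a (1 + log R)^n`,
which at `a = e` is the `hvol` binder of ★ `integrable_orbitalIntegrand_of_archSchwartzOn_of_volumeGrowth` (p848851): the orbital integrand `ȳ ↦ g(y γ_c y⁻¹)` is `(m c)`-integrable.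
On `U(2,1)`-factors `e = 1`; the per-place tokens are the bricks (E′) (regular elliptic classes; LH2-p02 (g2) ∕ LH2-p01 (g3)) and (H′) (regular classes meeting the non-compact
Cartan; open) of the LH2 kit board.

* §1 `archHSGL_arch_eq_prod_hs_archPiEquivCM`, `archHSGL_archPiEquivCM_symm` (entries of the place components are ★ `coe_archPiEquivCM_apply`, `rfl`) — the radius
  `archHSGL` IS the product of the per-place squared HS norms (★ `archHSGL` :70 is defined as this product; named here so consumers can cite it).
* §2 **`measure_setOf_descConj_archHSGL_arch_le_of_isQuotientOf`** — the (W) reading: «places multiply» for the member `m c` of a Weil-form family at a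
  regular class.
* §3 **`integrable_orbitalIntegrand_of_archSchwartzOn_of_placewise_growth`** (+ `…_antidiagOne_…`, `J = Φ_N`; at `N = 3`, `e = 1`: `𝒞(G_∞) = ArchSchwartzOn L 3 Φ₃ 1`) — the
  JUNCTION ★ p848851 ∘ §2.
HONEST LABEL: HC_CM is proved only modulo the 7 printed citations (2 remaining: hLiu418 = `stmt-HodgeConjecture-24832`, h413 = `stmt-HodgeConjecture-24833`) until rung 0
closes; this file is (VOL)∕(CONV) plumbing, count-neutral (+0∕+0): it certifies that the Schwartz orbital integrals of the letters O1″∕O3″ of `stub_N8` are honest Bochner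
integrals at every regular class modulo the one per-place token; it pays no organ.

## References
* [BeuzartPlessis2020Asterisque] R. Beuzart-Plessis, *A local trace formula for the Gan–Gross–Prasad conjecture for unitary groups: the archimedean case*,
  Astérisque 418 (2020), §1.5 (1.5.2)–(1.5.3) p. 31 (polynomial growth of weighted balls; convergence of Schwartz orbital integrals); Prop. 1.5.1 (i) pp. 29–30.
* [HarishChandra1966] Harish-Chandra, *Discrete series for semisimple Lie groups II*, Acta Math. 116 (1966), §9 (convergence of Schwartz orbital integrals).
* [Rogawski1990] J. D. Rogawski, *Automorphic Representations of Unitary Groups in Three Variables*, Ann. of Math. Stud. 123 (1990), §1.7 p. 6, §4.3 (4.3.1) p. 43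
  (compatible measures, orbital integrals), §4.9 Prop. 4.9.1 (a) p. 55, §14.2 (14.2.1) p. 232 (the archimedean inner-form transfer).
* [DeitmarEchterhoff2014] A. Deitmar, S. Echterhoff, *Principles of Harmonic Analysis*, 2nd ed., Thm. 1.5.3 (invariant quotient measures).
* [Gelbart1975] S. Gelbart, *Automorphic Forms on Adele Groups*, Ann. of Math. Stud. 83 (1975), p. 155 (10.19) (orbital integrals factor over places).
-/

set_option autoImplicit false

noncomputable section

open MeasureTheory MeasureTheory.Measure NumberField NumberField.InfinitePlace NumberField.mixedEmbedding
open Literature.MeasureTheory.Group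
open Literature.NumberTheory.Automorphic Literature.NumberTheory.Automorphic.UnitaryGroup
open scoped ENNReal NNReal MatrixGroups Classical ComplexOrder

namespace Literature.NumberTheory.Rogawski1990

/-! ## §1 The radius `archHSGL` in place coordinates; the per-place radius is `≥ 1` -/

section Coordinates

variable (L : Type) [Field L] [NumberField L] [IsCMField L] (N : ℕ) (J : Matrix (Fin N) (Fin N) L)

/-- **`archHSGL L N y = ∏_w ‖(archPiEquivCM N L J y)_w‖²_HS`** — the radius of ★ `ArchSchwartzOn` ∕ ★ `integrable_descConj_of_archSchwartzOn_of_volumeGrowth` is the product over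
the complex places of the squared Hilbert–Schmidt norms of the place components (★ `archHSGL` is defined by exactly this product; the place components are read
through ★ `archPiEquivCM`). [cite: BeuzartPlessis2020Asterisque, §1.5 Prop. 1.5.1 (i) pp. 29–30] -/
theorem archHSGL_arch_eq_prod_hs_archPiEquivCM (y : ↥(UnitaryGroup.arch (↥(maximalRealSubfield L)) L (IsCMField.complexConj L) N J)) :
    archHSGL L N (y : GL (Fin N) (mixedSpace L)) =
      ∏ w : {w : InfinitePlace L // w.IsComplex},
        ∑ i : Fin N, ∑ j : Fin N, ‖(((archPiEquivCM N L J y w : ↥(archLocal L N J w)) : GL (Fin N) ℂ) : Matrix (Fin N) (Fin N) ℂ) i j‖ ^ 2 := by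
  unfold archHSGL
  rfl

/-- **The radius in product coordinates**: `archHSGL L N (archPiEquivCM⁻¹ u) = ∏_w ‖u_w‖²_HS` — the factorisation hypothesis `hΦ` of ★
`measure_setOf_descConj_le_of_pi_marginal_growth` for `e = archPiEquivCM⁻¹`. [cite: Gelbart1975, p. 155 (10.19)] [cite: BeuzartPlessis2020Asterisque, §1.5 Prop. 1.5.1 (i) pp. 29–30] -/
theorem archHSGL_archPiEquivCM_symm (u : ∀ w : {w : InfinitePlace L // w.IsComplex}, ↥(archLocal L N J w)) :
    archHSGL L N (((archPiEquivCM N L J).symm u : ↥(UnitaryGroup.arch (↥(maximalRealSubfield L)) L (IsCMField.complexConj L) N J)) : GL (Fin N) (mixedSpace L)) =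
      ∏ w : {w : InfinitePlace L // w.IsComplex}, ∑ i : Fin N, ∑ j : Fin N, ‖(((u w : ↥(archLocal L N J w)) : GL (Fin N) ℂ) : Matrix (Fin N) (Fin N) ℂ) i j‖ ^ 2 := by
  rw [archHSGL_arch_eq_prod_hs_archPiEquivCM, ContinuousMulEquiv.apply_symm_apply]

end Coordinates

/-! ## §2 The (W) reading: members of a Weil-form family at the regular classes (the LH2 frame ★ `ArchCompatibleFamiliesG`) -/

section WeilForm

variable (L : Type) [Field L] [NumberField L] [IsCMField L] (N : ℕ) [NeZero N] {J : Matrix (Fin N) (Fin N) L}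
    [MeasurableSpace ↥(UnitaryGroup.arch (↥(maximalRealSubfield L)) L (IsCMField.complexConj L) N J)]
    [BorelSpace ↥(UnitaryGroup.arch (↥(maximalRealSubfield L)) L (IsCMField.complexConj L) N J)]

/-- **(W) READING — the `hvol` binder at a member of a Weil-form family.**  For `ν` Haar and right-invariant on `U(J)_∞` (`det J ≠ 0`, `N ≥ 1`), centraliser measures `t`,
an orbital-measure family `m` in WEIL FORM at the regular classes (★ `OrbitalMeasureFamily.IsQuotientOf (fun γ => IsRegularElt γ) ν t` — conjuncts (W′)∕(W) of the LH2 frame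
★ `ArchCompatibleFamiliesG`: `m c = dν ∕ dt_{γ_c}`, `γ_c = out c`, ★ `quotientMeasure`) and a regular class `c`: the orbit HS-balls of `m c` grow like `A R^a (1 + log R)^m` as soon
as, at each complex place `w`, SOME non-zero invariant σ-finite measure on `U(J)_w ⧸ Z_w((γ_c)_w)` finite on compact sets has orbit HS-balls growing like `C ρ^a` (`m c` is
invariant and Radon: ★ `smulInvariantMeasure_quotientMeasure'`, ★ `regular_quotientMeasure`; then §2).
[cite: Rogawski1990, §1.7 p. 6; §4.3 (4.3.1) p. 43; §14.2 (14.2.1) p. 232] [cite: DeitmarEchterhoff2014, Thm. 1.5.3] [cite: BeuzartPlessis2020Asterisque, §1.5 (1.5.2)–(1.5.3) p. 31] -/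
theorem measure_setOf_descConj_archHSGL_arch_le_of_isQuotientOf (hJ : J.det ≠ 0)
    (ν : Measure ↥(UnitaryGroup.arch (↥(maximalRealSubfield L)) L (IsCMField.complexConj L) N J)) [ν.IsHaarMeasure] [ν.IsMulRightInvariant]
    [∀ a : ↥(UnitaryGroup.arch (↥(maximalRealSubfield L)) L (IsCMField.complexConj L) N J),
      MeasurableSpace (↥(UnitaryGroup.arch (↥(maximalRealSubfield L)) L (IsCMField.complexConj L) N J) ⧸ Subgroup.centralizer ({a} : Set _))]
    [∀ a : ↥(UnitaryGroup.arch (↥(maximalRealSubfield L)) L (IsCMField.complexConj L) N J),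
      BorelSpace (↥(UnitaryGroup.arch (↥(maximalRealSubfield L)) L (IsCMField.complexConj L) N J) ⧸ Subgroup.centralizer ({a} : Set _))]
    (t : ∀ γ : ↥(UnitaryGroup.arch (↥(maximalRealSubfield L)) L (IsCMField.complexConj L) N J), Measure ↥(Subgroup.centralizer ({γ} : Set _)))
    (m : OrbitalMeasureFamily ↥(UnitaryGroup.arch (↥(maximalRealSubfield L)) L (IsCMField.complexConj L) N J))
    (hW : m.IsQuotientOf (fun γ => IsRegularElt (γ.val : GL (Fin N) (mixedSpace L))) ν t)
    (c : ConjClasses ↥(UnitaryGroup.arch (↥(maximalRealSubfield L)) L (IsCMField.complexConj L) N J))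
    (hc : IsRegularElt ((Quotient.out c).val : GL (Fin N) (mixedSpace L)))
    [∀ w : {w : InfinitePlace L // w.IsComplex}, MeasurableSpace (↥(archLocal L N J w) ⧸ Subgroup.centralizer ({archPiEquivCM N L J (Quotient.out c) w} : Set _))]
    [∀ w : {w : InfinitePlace L // w.IsComplex}, BorelSpace (↥(archLocal L N J w) ⧸ Subgroup.centralizer ({archPiEquivCM N L J (Quotient.out c) w} : Set _))]
    (μw : ∀ w : {w : InfinitePlace L // w.IsComplex}, Measure (↥(archLocal L N J w) ⧸ Subgroup.centralizer ({archPiEquivCM N L J (Quotient.out c) w} : Set _)))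
    [∀ w, SMulInvariantMeasure (↥(archLocal L N J w)) _ (μw w)] [∀ w, IsFiniteMeasureOnCompacts (μw w)] [∀ w, SigmaFinite (μw w)] (hμw : ∀ w, μw w ≠ 0)
    {a : ℝ} (ha : 0 ≤ a)
    (hplace : ∀ w, ∃ C : ℝ, ∀ ρ : ℝ, 1 ≤ ρ →
      μw w {x | descConj (archPiEquivCM N L J (Quotient.out c) w) (Subgroup.centralizer ({archPiEquivCM N L J (Quotient.out c) w} : Set _))
        (fun _ h => Subgroup.mem_centralizer_singleton_iff.1 h)
        (fun y : ↥(archLocal L N J w) => ∑ i : Fin N, ∑ j : Fin N, ‖((y : GL (Fin N) ℂ) : Matrix (Fin N) (Fin N) ℂ) i j‖ ^ 2) x ≤ ρ} ≤ ENNReal.ofReal (C * ρ ^ a)) :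
    ∃ (A : ℝ) (n : ℕ), ∀ R : ℝ, 1 ≤ R →
      (m c) {x | descConj (Quotient.out c) (Subgroup.centralizer ({Quotient.out c} : Set _)) (fun _ h => Subgroup.mem_centralizer_singleton_iff.1 h)
            (fun y : ↥(UnitaryGroup.arch (↥(maximalRealSubfield L)) L (IsCMField.complexConj L) N J) => archHSGL L N (y : GL (Fin N) (mixedSpace L))) x ≤ R} ≤
        ENNReal.ofReal (A * R ^ a * (1 + Real.log R) ^ n) := by
  -- (W) at the regular class `c`: `m c` IS the quotient of `ν` by the Haar measure `t (out c)`
  obtain ⟨hHaar, hInv, hmc⟩ := hW c hc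
  rw [hmc]
  exact measure_setOf_descConj_archHSGL_arch_le L hJ (Quotient.out c) _ μw hμw ha hplace

end WeilForm

/-! ## §3 The junction: (CONV) on `U(J)_∞` at a regular class from the one per-place token -/

section Junction

variable (L : Type) [Field L] [NumberField L] [IsCMField L] (N : ℕ) [NeZero N] {J : Matrix (Fin N) (Fin N) L}
    [MeasurableSpace ↥(UnitaryGroup.arch (↥(maximalRealSubfield L)) L (IsCMField.complexConj L) N J)]
    [BorelSpace ↥(UnitaryGroup.arch (↥(maximalRealSubfield L)) L (IsCMField.complexConj L) N J)]

/-- **(CONV) ON `U(J)_∞` AT A REGULAR CLASS, BY THE ONE PER-PLACE TOKEN** — the `G`-side twin of ★ `integrable_orbitalIntegrand_of_archSchwartzGL_of_placewise_growth`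
(LH3-p04, p848924).  For `det J ≠ 0`, `N ≥ 1`, `g ∈ 𝒞(U(J)_∞)` = ★ `ArchSchwartzOn L N J e g` (`e > 0`), `ν` Haar and right-invariant, a Weil-form family `m` at the regular
classes ((W): ★ `IsQuotientOf`) and a regular class `c`: IF at every complex place `w` some non-zero invariant σ-finite measure `μ_w` on `U(J)_w ⧸ Z_w((out c)_w)` finite
on compact sets has `μ_w{x̄ ∣ ‖x̄ (out c)_w x̄⁻¹‖²_HS ≤ ρ} ≤ C ρ^e` (`ρ ≥ 1`) — the token `hplace`, exponent `a = e` — THEN the orbital integrand `ȳ ↦ g(y · out c · y⁻¹)`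
(★ `descConj`) is `(m c)`-integrable: ★ `integrable_orbitalIntegrand_of_archSchwartzOn_of_volumeGrowth` (p848851) fed by §3.  So ★ `classOrbitalIntegral m g c` and the
summands of the stable orbital integrals of the letters O1″∕O3″ at such classes are honest Bochner integrals.
[cite: BeuzartPlessis2020Asterisque, §1.5 (1.5.2)–(1.5.3) p. 31] [cite: HarishChandra1966, §9] [cite: Rogawski1990, §4.9 Prop. 4.9.1 (a) p. 55; §14.2 (14.2.1) p. 232] -/
theorem integrable_orbitalIntegrand_of_archSchwartzOn_of_placewise_growth (hJ : J.det ≠ 0) {e : ℝ} (he : 0 < e)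
    {g : ↥(UnitaryGroup.arch (↥(maximalRealSubfield L)) L (IsCMField.complexConj L) N J) → ℂ} (hg : ArchSchwartzOn L N J e g)
    (ν : Measure ↥(UnitaryGroup.arch (↥(maximalRealSubfield L)) L (IsCMField.complexConj L) N J)) [ν.IsHaarMeasure] [ν.IsMulRightInvariant]
    [∀ a : ↥(UnitaryGroup.arch (↥(maximalRealSubfield L)) L (IsCMField.complexConj L) N J),
      MeasurableSpace (↥(UnitaryGroup.arch (↥(maximalRealSubfield L)) L (IsCMField.complexConj L) N J) ⧸ Subgroup.centralizer ({a} : Set _))]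
    [∀ a : ↥(UnitaryGroup.arch (↥(maximalRealSubfield L)) L (IsCMField.complexConj L) N J),
      BorelSpace (↥(UnitaryGroup.arch (↥(maximalRealSubfield L)) L (IsCMField.complexConj L) N J) ⧸ Subgroup.centralizer ({a} : Set _))]
    (t : ∀ γ : ↥(UnitaryGroup.arch (↥(maximalRealSubfield L)) L (IsCMField.complexConj L) N J), Measure ↥(Subgroup.centralizer ({γ} : Set _)))
    (m : OrbitalMeasureFamily ↥(UnitaryGroup.arch (↥(maximalRealSubfield L)) L (IsCMField.complexConj L) N J))
    (hW : m.IsQuotientOf (fun γ => IsRegularElt (γ.val : GL (Fin N) (mixedSpace L))) ν t)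
    (c : ConjClasses ↥(UnitaryGroup.arch (↥(maximalRealSubfield L)) L (IsCMField.complexConj L) N J))
    (hc : IsRegularElt ((Quotient.out c).val : GL (Fin N) (mixedSpace L)))
    [∀ w : {w : InfinitePlace L // w.IsComplex}, MeasurableSpace (↥(archLocal L N J w) ⧸ Subgroup.centralizer ({archPiEquivCM N L J (Quotient.out c) w} : Set _))]
    [∀ w : {w : InfinitePlace L // w.IsComplex}, BorelSpace (↥(archLocal L N J w) ⧸ Subgroup.centralizer ({archPiEquivCM N L J (Quotient.out c) w} : Set _))]
    (μw : ∀ w : {w : InfinitePlace L // w.IsComplex}, Measure (↥(archLocal L N J w) ⧸ Subgroup.centralizer ({archPiEquivCM N L J (Quotient.out c) w} : Set _)))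
    [∀ w, SMulInvariantMeasure (↥(archLocal L N J w)) _ (μw w)] [∀ w, IsFiniteMeasureOnCompacts (μw w)] [∀ w, SigmaFinite (μw w)] (hμw : ∀ w, μw w ≠ 0)
    (hplace : ∀ w, ∃ C : ℝ, ∀ ρ : ℝ, 1 ≤ ρ →
      μw w {x | descConj (archPiEquivCM N L J (Quotient.out c) w) (Subgroup.centralizer ({archPiEquivCM N L J (Quotient.out c) w} : Set _))
        (fun _ h => Subgroup.mem_centralizer_singleton_iff.1 h)
        (fun y : ↥(archLocal L N J w) => ∑ i : Fin N, ∑ j : Fin N, ‖((y : GL (Fin N) ℂ) : Matrix (Fin N) (Fin N) ℂ) i j‖ ^ 2) x ≤ ρ} ≤ ENNReal.ofReal (C * ρ ^ e)) :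
    Integrable (descConj (Quotient.out c) (Subgroup.centralizer ({Quotient.out c} : Set _))
      (fun _ h => Subgroup.mem_centralizer_singleton_iff.1 h) g) (m c) :=
  integrable_orbitalIntegrand_of_archSchwartzOn_of_volumeGrowth L N hJ he hg m c
    (measure_setOf_descConj_archHSGL_arch_le_of_isQuotientOf L N hJ ν t m hW c hc μw hμw he.le hplace)

/-- **`J = Φ_N`, the JUNCTION on `G_∞ = U(Φ_N)_∞`** (at `N = 3`, `e = 1`: the Schwartz class ★ `ArchSchwartzOn L 3 Φ₃ 1` of the letters O1″∕O3″ of `stub_N8`, and the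
Weil-form family `m` of the frame ★ `ArchCompatibleFamiliesG`): the orbital integrand of `g ∈ 𝒞(G_∞)` at a regular class `c` is `(m c)`-integrable given the one per-place
token `hplace` with exponent `e`. [cite: BeuzartPlessis2020Asterisque, §1.5 (1.5.2)–(1.5.3) p. 31] [cite: Rogawski1990, §4.9 Prop. 4.9.1 (a) p. 55; §14.2 (14.2.1) p. 232] -/
theorem integrable_orbitalIntegrand_of_archSchwartzOn_antidiagOne_of_placewise_growth {e : ℝ} (he : 0 < e)
    [MeasurableSpace ↥(UnitaryGroup.arch (↥(maximalRealSubfield L)) L (IsCMField.complexConj L) N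
      (Matrix.of fun i j : Fin N => if i.val + j.val + 1 = N then (1 : L) else 0))]
    [BorelSpace ↥(UnitaryGroup.arch (↥(maximalRealSubfield L)) L (IsCMField.complexConj L) N
      (Matrix.of fun i j : Fin N => if i.val + j.val + 1 = N then (1 : L) else 0))]
    {g : ↥(UnitaryGroup.arch (↥(maximalRealSubfield L)) L (IsCMField.complexConj L) N
      (Matrix.of fun i j : Fin N => if i.val + j.val + 1 = N then (1 : L) else 0)) → ℂ}
    (hg : ArchSchwartzOn L N (Matrix.of fun i j : Fin N => if i.val + j.val + 1 = N then (1 : L) else 0) e g)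
    (ν : Measure ↥(UnitaryGroup.arch (↥(maximalRealSubfield L)) L (IsCMField.complexConj L) N
      (Matrix.of fun i j : Fin N => if i.val + j.val + 1 = N then (1 : L) else 0))) [ν.IsHaarMeasure] [ν.IsMulRightInvariant]
    [∀ a : ↥(UnitaryGroup.arch (↥(maximalRealSubfield L)) L (IsCMField.complexConj L) N
        (Matrix.of fun i j : Fin N => if i.val + j.val + 1 = N then (1 : L) else 0)),
      MeasurableSpace (↥(UnitaryGroup.arch (↥(maximalRealSubfield L)) L (IsCMField.complexConj L) N
        (Matrix.of fun i j : Fin N => if i.val + j.val + 1 = N then (1 : L) else 0)) ⧸ Subgroup.centralizer ({a} : Set _))]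
    [∀ a : ↥(UnitaryGroup.arch (↥(maximalRealSubfield L)) L (IsCMField.complexConj L) N
        (Matrix.of fun i j : Fin N => if i.val + j.val + 1 = N then (1 : L) else 0)),
      BorelSpace (↥(UnitaryGroup.arch (↥(maximalRealSubfield L)) L (IsCMField.complexConj L) N
        (Matrix.of fun i j : Fin N => if i.val + j.val + 1 = N then (1 : L) else 0)) ⧸ Subgroup.centralizer ({a} : Set _))]
    (t : ∀ γ : ↥(UnitaryGroup.arch (↥(maximalRealSubfield L)) L (IsCMField.complexConj L) N
        (Matrix.of fun i j : Fin N => if i.val + j.val + 1 = N then (1 : L) else 0)), Measure ↥(Subgroup.centralizer ({γ} : Set _)))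
    (m : OrbitalMeasureFamily ↥(UnitaryGroup.arch (↥(maximalRealSubfield L)) L (IsCMField.complexConj L) N
      (Matrix.of fun i j : Fin N => if i.val + j.val + 1 = N then (1 : L) else 0)))
    (hW : m.IsQuotientOf (fun γ => IsRegularElt (γ.val : GL (Fin N) (mixedSpace L))) ν t)
    (c : ConjClasses ↥(UnitaryGroup.arch (↥(maximalRealSubfield L)) L (IsCMField.complexConj L) N
      (Matrix.of fun i j : Fin N => if i.val + j.val + 1 = N then (1 : L) else 0)))
    (hc : IsRegularElt ((Quotient.out c).val : GL (Fin N) (mixedSpace L)))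
    [∀ w : {w : InfinitePlace L // w.IsComplex}, MeasurableSpace (↥(archLocal L N (Matrix.of fun i j : Fin N => if i.val + j.val + 1 = N then (1 : L) else 0) w) ⧸
      Subgroup.centralizer ({archPiEquivCM N L (Matrix.of fun i j : Fin N => if i.val + j.val + 1 = N then (1 : L) else 0) (Quotient.out c) w} : Set _))]
    [∀ w : {w : InfinitePlace L // w.IsComplex}, BorelSpace (↥(archLocal L N (Matrix.of fun i j : Fin N => if i.val + j.val + 1 = N then (1 : L) else 0) w) ⧸
      Subgroup.centralizer ({archPiEquivCM N L (Matrix.of fun i j : Fin N => if i.val + j.val + 1 = N then (1 : L) else 0) (Quotient.out c) w} : Set _))]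
    (μw : ∀ w : {w : InfinitePlace L // w.IsComplex}, Measure (↥(archLocal L N (Matrix.of fun i j : Fin N => if i.val + j.val + 1 = N then (1 : L) else 0) w) ⧸
      Subgroup.centralizer ({archPiEquivCM N L (Matrix.of fun i j : Fin N => if i.val + j.val + 1 = N then (1 : L) else 0) (Quotient.out c) w} : Set _)))
    [∀ w, SMulInvariantMeasure (↥(archLocal L N (Matrix.of fun i j : Fin N => if i.val + j.val + 1 = N then (1 : L) else 0) w)) _ (μw w)]
    [∀ w, IsFiniteMeasureOnCompacts (μw w)] [∀ w, SigmaFinite (μw w)] (hμw : ∀ w, μw w ≠ 0)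
    (hplace : ∀ w, ∃ C : ℝ, ∀ ρ : ℝ, 1 ≤ ρ →
      μw w {x | descConj (archPiEquivCM N L (Matrix.of fun i j : Fin N => if i.val + j.val + 1 = N then (1 : L) else 0) (Quotient.out c) w)
        (Subgroup.centralizer ({archPiEquivCM N L (Matrix.of fun i j : Fin N => if i.val + j.val + 1 = N then (1 : L) else 0) (Quotient.out c) w} : Set _))
        (fun _ h => Subgroup.mem_centralizer_singleton_iff.1 h)
        (fun y : ↥(archLocal L N (Matrix.of fun i j : Fin N => if i.val + j.val + 1 = N then (1 : L) else 0) w) =>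
          ∑ i : Fin N, ∑ j : Fin N, ‖((y : GL (Fin N) ℂ) : Matrix (Fin N) (Fin N) ℂ) i j‖ ^ 2) x ≤ ρ} ≤ ENNReal.ofReal (C * ρ ^ e)) :
    Integrable (descConj (Quotient.out c) (Subgroup.centralizer ({Quotient.out c} : Set _))
      (fun _ h => Subgroup.mem_centralizer_singleton_iff.1 h) g) (m c) :=
  integrable_orbitalIntegrand_of_archSchwartzOn_of_placewise_growth L N (UnitaryGroup.isUnit_antidiagOne_det L N).ne_zero he hg ν t m hW c hc μw hμw hplace

end Junction

end Literature.NumberTheory.Rogawski1990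

end
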